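import Summits.RiemannHypothesis.RiemannHypothesis.Theses.IntegerScrew
import Summits.RiemannHypothesis.RiemannHypothesis.Theorems.IntegerScrewScrewPolyFloorStructure
import Summits.RiemannHypothesis.RiemannHypothesis.Theorems.IntegerScrewDiscreteLandau
import Literature.NumberTheory.LFunctions.ZetaScrewThm12Proofs
import Literature.NumberTheory.LFunctions.ZetaScrewThm17Proofs
import HarnessLib

/-!
# `IntegerScrew.ScrewPolyFloor` (stmt-RiemannHypothesis-15757) — STRUCTURE AND SPLIT GLUE

Landed verbatim (up to this header) from the crux-strategist's re-audit r1 file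
`Cruxes/ScrewPolyFloor/IntegerScrewScrewPolyFloorSplit.lean` (2026-08-17), at the planners' request,
so that a `route edit --split ScrewPolyFloor` has prover-landed `--glue-by` theorems to name.
Companion: `Theorems/IntegerScrewScrewPolyFloorStructure.lean` (`IntegerScrew.screwPolyFloor_iff_riemannHypothesis`,
`IntegerScrew.screwPolyFloor_iff_integerScrewPSD`).

`ScrewPolyFloor : ∃ A c > 0, ∀ M x, c·M^{-A}·Σ_{2≤m≤M} x_m² ≤ x·S_M·x`.  Against the CURRENT tree
(`screwDensityDetection_proof` and `DiscreteLandau_proof` LANDED) this file kernel-checks: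

* the STRUCTURE THEOREM  `ScrewPolyFloor ↔ RiemannHypothesis ∧ FloorOfRH`
  (and `↔ IntegerScrewPSD ∧ FloorOfRH`, `↔ (∀ m ≥ 1, 0 ≤ Ψ(log m)) ∧ FloorOfRH`);
* the candidate ASSEMBLIES for `route edit --split ScrewPolyFloor`:
  `screwPolyFloor_of_subs : IntegerScrewPSD → ScrewDensityDetection → FloorOfRH → ScrewPolyFloor` (k = 3, all EXISTING items),
  `screwPolyFloor_of_target_floor : IntegerScrewPSD → FloorOfRH → ScrewPolyFloor` (k = 2),
  `screwPolyFloor_of_diag_floor : (∀ m ≥ 1, 0 ≤ Ψ(log m)) → FloorOfRH → ScrewPolyFloor` (k = 2);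
* the RH-equivalence of the diagonal piece, `screwDiagonalPositivity_iff_riemannHypothesis`
  (the target's, `IntegerScrew.integerScrewPSD_iff_riemannHypothesis`, and
  `IntegerScrew.riemannHypothesis_of_integerScrewPSD` / `screwConverse_proof` are imported from
  `Theorems/IntegerScrewScrewPolyFloorStructure.lean` / `…ScrewConverse.lean`, not restated).

Every seam is modus ponens plus one landed theorem (`trivial_seam`).  No `sorry`.
-/

noncomputable section

-- the layout-mandated namespace repeats the summit name
set_option linter.dupNamespace false

namespace Summit.RiemannHypothesis.RiemannHypothesis.Theorems.IntegerScrewSplit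

open Summit.RiemannHypothesis.RiemannHypothesis.Theses.IntegerScrew
open Literature.NumberTheory.LFunctions
open scoped BigOperators

/-! ## The RH half -/

-- TARGET ⇔ RH is LANDED: `IntegerScrew.riemannHypothesis_of_integerScrewPSD`,
-- `IntegerScrew.integerScrewPSD_iff_riemannHypothesis` (Theorems/IntegerScrewScrewPolyFloorStructure.lean)
-- and `screwConverse_proof : ScrewConverse` (RH ⇒ TARGET, Theorems/IntegerScrewScrewConverse.lean).

/-- DIAGONAL ⇒ RH is the landed crux 3 (`DiscreteLandau_proof`); RH ⇒ DIAGONAL is Thm 1.7 restricted. -/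
theorem screwDiagonalPositivity_iff_riemannHypothesis :
    (∀ m : ℕ, 1 ≤ m → 0 ≤ zetaScrew (Real.log m)) ↔ _root_.RiemannHypothesis := by
  constructor
  · intro hd
    exact Summit.RiemannHypothesis.RiemannHypothesis.Theorems.IntegerScrewDiscreteLandau.DiscreteLandau_proof hd
  · intro h m _
    exact (Suzuki2023_thm17_holds).1.1 h (Real.log m)

/-! ## What the crux gives -/

/-- The crux's diagonal: `ScrewPolyFloor ⇒ Ψ(log m) ≥ 0` for every `m ≥ 1` (test vector = indicator
of `m`; verbatim the `hdiag` step of the route's `closes`). -/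
theorem diag_of_screwPolyFloor (hF : ScrewPolyFloor) (m : ℕ) (hm1 : 1 ≤ m) :
    0 ≤ zetaScrew (Real.log m) := by
  classical
  rcases Nat.lt_or_ge m 2 with hlt | hm
  · have h1 : m = 1 := by omega
    subst h1
    simp [zetaScrew_zero]
  obtain ⟨A, c, hc, h⟩ := hF
  set x : ℕ → ℝ := fun k => if k = m then 1 else 0 with hx
  have hmem : m ∈ Finset.Icc 2 m := Finset.mem_Icc.mpr ⟨hm, le_rfl⟩
  have h1 := h m x
  have hR : ∑ a ∈ Finset.Icc 2 m, ∑ b ∈ Finset.Icc 2 m,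
      zetaScrewKernel (Real.log a) (Real.log b) * (x a * x b) =
        zetaScrewKernel (Real.log m) (Real.log m) := by
    rw [Finset.sum_eq_single m]
    · rw [Finset.sum_eq_single m]
      · simp [hx]
      · intro b _ hb
        simp [hx, hb]
      · intro hnot
        exact absurd hmem hnot
    · intro a _ ha
      apply Finset.sum_eq_zero
      intro b _
      simp [hx, ha]
    · intro hnot
      exact absurd hmem hnot
  have hL0 : 0 ≤ c * (m : ℝ) ^ (-A) * ∑ a ∈ Finset.Icc 2 m, x a ^ 2 :=
    mul_nonneg (mul_nonneg hc.le (Real.rpow_nonneg (Nat.cast_nonneg m) _))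
      (Finset.sum_nonneg fun _ _ => sq_nonneg _)
  have h2 : 0 ≤ zetaScrewKernel (Real.log m) (Real.log m) := by
    rw [← hR]; exact le_trans hL0 h1
  rw [zetaScrewKernel_self] at h2
  linarith

/-- `ScrewPolyFloor ⇒ RH` (diagonal + landed `DiscreteLandau_proof`). -/
theorem riemannHypothesis_of_screwPolyFloor (hF : ScrewPolyFloor) : _root_.RiemannHypothesis :=
  screwDiagonalPositivity_iff_riemannHypothesis.1 (diag_of_screwPolyFloor hF)

/-- `ScrewPolyFloor ⇒ FloorOfRH` (weakening). -/
theorem floorOfRH_of_screwPolyFloor (hF : ScrewPolyFloor) : FloorOfRH := fun _ => hF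

/-- `ScrewPolyFloor ⇒ IntegerScrewPSD` through RH (the route's `FloorImpliesScrew` has an
elementary aggregation proof too; this is the two-line one). -/
theorem target_of_screwPolyFloor (hF : ScrewPolyFloor) : IntegerScrewPSD :=
  screwConverse_proof (riemannHypothesis_of_screwPolyFloor hF)

/-! ## Assemblies (candidate `--split` glue) -/

/-- VARIANT A (k = 3; children = the EXISTING items target / ScrewDensityDetection / FloorOfRH):
`IntegerScrewPSD → ScrewDensityDetection → FloorOfRH → ScrewPolyFloor`.  Seam: density detection
carries PSD to all real configurations, Suzuki2023 Thm 1.2 gives RH, `FloorOfRH := RH → floor`. -/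
theorem screwPolyFloor_of_subs :
    IntegerScrewPSD → ScrewDensityDetection → FloorOfRH → ScrewPolyFloor :=
  fun hP hD hF => hF ((Suzuki2023_thm12.iff_real Suzuki2023_thm12_holds).2 (hD hP))

/-- VARIANT A′ (k = 2): `IntegerScrewPSD → FloorOfRH → ScrewPolyFloor` (density detection used as
the landed theorem it now is). -/
theorem screwPolyFloor_of_target_floor (hP : IntegerScrewPSD) (hF : FloorOfRH) : ScrewPolyFloor :=
  hF (IntegerScrew.riemannHypothesis_of_integerScrewPSD hP)

/-- VARIANT B′ (k = 2): `(∀ m ≥ 1, 0 ≤ Ψ(log m)) → FloorOfRH → ScrewPolyFloor` (the diagonal — the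
only consequence of the crux that `closes` consumes — and the floor law under RH; bridge = landed
`DiscreteLandau_proof`). -/
theorem screwPolyFloor_of_diag_floor (hd : ∀ m : ℕ, 1 ≤ m → 0 ≤ zetaScrew (Real.log m))
    (hF : FloorOfRH) : ScrewPolyFloor :=
  hF (screwDiagonalPositivity_iff_riemannHypothesis.1 hd)

/-- VARIANT B (k = 3, bridge as an explicit piece): `D → DiscreteLandau → FloorOfRH → ScrewPolyFloor`. -/
theorem screwPolyFloor_of_diag (hd : ∀ m : ℕ, 1 ≤ m → 0 ≤ zetaScrew (Real.log m))
    (hL : DiscreteLandau) (hF : FloorOfRH) : ScrewPolyFloor :=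
  hF (hL hd)

/-! ## Structure theorems -/

/-- **`ScrewPolyFloor ↔ RH ∧ FloorOfRH`.** -/
theorem screwPolyFloor_iff_rh_and_floor : ScrewPolyFloor ↔ _root_.RiemannHypothesis ∧ FloorOfRH :=
  ⟨fun h => ⟨riemannHypothesis_of_screwPolyFloor h, floorOfRH_of_screwPolyFloor h⟩,
    fun h => h.2 h.1⟩

/-- **`ScrewPolyFloor ↔ IntegerScrewPSD ∧ FloorOfRH`.** -/
theorem screwPolyFloor_iff_target_and_floor : ScrewPolyFloor ↔ IntegerScrewPSD ∧ FloorOfRH :=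
  ⟨fun h => ⟨target_of_screwPolyFloor h, floorOfRH_of_screwPolyFloor h⟩,
    fun h => screwPolyFloor_of_target_floor h.1 h.2⟩

/-- **`ScrewPolyFloor ↔ (∀ m ≥ 1, 0 ≤ Ψ(log m)) ∧ FloorOfRH`.** -/
theorem screwPolyFloor_iff_diag_and_floor :
    ScrewPolyFloor ↔ (∀ m : ℕ, 1 ≤ m → 0 ≤ zetaScrew (Real.log m)) ∧ FloorOfRH :=
  ⟨fun h => ⟨diag_of_screwPolyFloor h, floorOfRH_of_screwPolyFloor h⟩,
    fun h => screwPolyFloor_of_diag_floor h.1 h.2⟩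

/-- Under ¬RH the floor piece is free: `¬RH → FloorOfRH` (so `FloorOfRH` can never give RH). -/
theorem floorOfRH_of_not_rh (h : ¬ _root_.RiemannHypothesis) : FloorOfRH := fun hRH => absurd hRH h

end Summit.RiemannHypothesis.RiemannHypothesis.Theorems.IntegerScrewSplit

end
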